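import Summits.SmoothPoincare4.SmoothPoincare4.Theses.SymplecticOrigami
import Literature.Geometry.Symplectic.AlmostComplexStructure
import Literature.Geometry.Symplectic.GromovR4RelEnd
import Literature.Geometry.Symplectic.GromovR4RelEndProofs
import Literature.Geometry.Symplectic.GromovR4StdModel

/-!
# Line `cross-cap-laurent` — skeleton for crux `SymplecticOrigami.GromovRecognitionRelEnd`

(item stmt-SmoothPoincare4-11009; routes SymplecticOrigami (rank 5) and SymplecticCap (rank 3) want
it; the route decl IS `Literature.Geometry.Symplectic.gromov_recognitionR4_relEnd` by `Iff.rfl`,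
McDuff–Salamon 2017 Rem. 4.5.2 (viii), held copy PDF p. 193; idea card
`Cruxes/GromovRecognitionRelEnd/Ideas/cross-cap-laurent.md`, triage r1-1/2/3: pass ×3, merged by the
panel with `ruled-cap-incidence-shear` and `wedge-pencils-flat-chart` — same lever.)

Crux (fixed, never restated): a connected symplectic 4-manifold `(M, sf)` with `π₂ = 0` whose end
`Kᶜ` is symplectomorphic by `ψ` (inverse `χ`) to the neighbourhood of infinity `{R < ‖z‖}` of
`(ℝ⁴, ω₀)`, every sub-end co-compact, is symplectomorphic to `(ℝ⁴, ω₀)` by a `Φ` with `Φ = ψ` off a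
compact set.

## The line: cap the end by the CROSS `ℂP¹ ∨ ℂP¹`, take `J` integrable (`= i ⊕ i`) on end ∪ cap,
## read Gromov–McDuff's two `J`-sphere fibrations in the cap's affine coordinates — they ARE `ψ` off
## the cross and `C¹`-flat along its arms (Laurent tails = smoothness at the wedge) — cut the chart
## off to `ψ` on a far shell, and finish by the split-TAME linear Moser path with compact support.

Data flow of the six registered stubs (`ω₀ = stdSymplecticForm = dx₀∧dx₁ + dx₂∧dx₃`, `ℂ² ∋ (z₁, z₂)`,
`z₁ = x₀ + i x₁`, `z₂ = x₂ + i x₃`, `i ⊕ i = (x₀,x₁,x₂,x₃) ↦ (-x₁,x₀,-x₃,x₂)`; all radii explicit):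

* `stub_endDoesNotReturn` (S/M; the panel's COMMON FINDING, Disproof `resists` bullet 1): for every
  `R' > R` the truncation `K ∪ {‖ψ‖ < R'}` is OPEN — the `∞`-side of the end does not accumulate on
  `K` (frontier/volume argument; the only place where Hausdorffness of the cap is non-formal).
* `stub_tameJ` (M/L; Wendl Ex. 6.7 / MS2017 §4.1 made relative): an `sf`-tame almost complex
  structure `J` on `M` equal to `ψ*(i ⊕ i)` on the SUB-end `{‖ψ‖ > R₁}`, `R₁ > max R 0` (triage: never
  up to `∂K`, Disproof §7 TwistEnd).
* `stub_capModel` (L; card S1 `CapExists`): the WEDGE CAP — a closed connected 4-manifold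
  `X = ι(M) ⊔ (H∞ ∪ V∞)` with a closed 2-form `ωX` taming an almost complex structure `JX` that
  extends `J` (`ι` holomorphic) and is the product structure in three explicit cap charts
  `ηV (u, z₂) = ι χ (1/u, z₂)`, `ηH (z₁, t) = ι χ (z₁, 1/t)`, `ηC (u, t) = ι χ (1/u, 1/t)` covering
  the two spheres at infinity `V∞ = {z₁ = ∞}`, `H∞ = {z₂ = ∞}`.
* `stub_biFoliation` (XL; the APEX = card S3 `TwoJFibrations` = wedge-pencils' "Theorem E′", Wendl
  2018 Thm E/6.8 pp. 137–139 with the one-component count in place of minimality + genericity, using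
  `π₂(M) = 0` exactly here): the two `JX`-sphere fibrations of `X` in the classes `[V∞]`, `[H∞]`, read
  on `M` in the cap coordinates, give a diffeomorphism `σ : M ≃ₘ ℝ⁴` whose coordinate foliations are
  `J`-complex (SPLIT) and positively oriented (`σ*ω₀` TAMES `J`), which is EXACTLY `ψ` in each
  coordinate on the corresponding slab `{|zₖ| > R₁}` (flat leaves) and extends SMOOTHLY over the
  wedge in the inverted charts (`= id` there) — the source of the Laurent/`O(1/ρ)` decay.
* `stub_flatCutoff` (M/L; card S4 `LaurentDecay` + S5 `SmallIsotopyExtension`): smoothness at the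
  wedge ⇒ `‖σ∘χ − id‖_{C¹} = O(1/ρ)` (Hadamard in `u = 1/z₁`, uniform on the compact label set
  `|z₂| ≤ R₁ + 1`, exact beyond) ⇒ straight-line cut-off to `ψ` on a far shell is a diffeomorphism
  `Φ₁ : M ≃ₘ ℝ⁴`, `Φ₁ = ψ` off a compact `K₁ ⊇ K`, and `Φ₁*ω₀` still tames `J`.
* `stub_tameMoser` (L; card S6+S7, = ruled-cap's triage-checked `TameMoserRelEnd` verbatim): both
  `sf` and `Φ₁*ω₀` tame `J` and agree off `K₁`, so the LINEAR path is symplectic and constant off a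
  compact set; `H²_c(ℝ⁴) = 0` gives a compactly supported Moser isotopy: `Φ = Φ₁ ∘ ρ₁`.
* `GromovRecognitionRelEnd_of` (PROVED, no `sorry` of its own): the six stubs BY NAME compose to the
  route decl (audit `#h21_check_skeleton`).

The pointwise split-taming lemma (card S6 `SplitTaming`, = `tameSplit`, Wendl p. 139 "σ₁ ⊕ σ₂ also
tames J₀") is KERNEL-CHECKED already (triage Scratch.lean; `Cruxes/…/SketchIdeator2.lean`) and is used
inside the apex to turn "split + orientation" into tameness; no separate stub.

## Disproof.lean honoured (cdisprove v3, 1712 lines, read 2026-08-16T04:10Z)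

* `gromovRecognitionRelEnd_false_without_ends` (H5): USED at `stub_endDoesNotReturn` (the shear end
  returns to `{y₁ = 0}` — exactly what the stub forbids), at `stub_capModel` (`X` compact Hausdorff),
  at `stub_flatCutoff` (`K₁ = K ∪ {‖ψ‖ ≤ 3r₁}` compact) — the line dies at stub 1 on the shear end.
* `gromovRecognitionRelEnd_false_without_pullback` (H10): USED at `stub_tameJ` (`ψ*(i⊕i)` is
  `sf`-tame only because `ψ` is symplectic; on the reflection witness it is `-sf`-tame), at
  `stub_capModel` (gluing `ωX := sf ∪ ψ*(τ⊕τ)`), at `stub_flatCutoff` (tameness on the cut-off shell is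
  read in `ψ`-coordinates where `sf = ω₀`) and verbatim as a hypothesis of `stub_tameMoser`.
* `gromovRecognitionRelEnd_false_withCompactK_of_pi2` / `_false_without_nondegenerate`: H5 is used in
  its full ENDS form (stub 1), H4 through tameness (stubs 2, 6).
* §7 `TwistEnd` + `not_gromovRecognitionRelEndStrong` (`K' = K` refuted): every stub shrinks the end —
  `J` standard only beyond `R₁ > R`, output `K' = K₁ ∪ supp ⊋ K`; no stub asserts `Φ = ψ` on `Kᶜ`.
* §8 `crux_iff_noChi`: `χ` is carried as decoration (it names the flat leaves and the cap charts).
* `isCompact_of_endsCoCompact`, `isClosed_of_endsCoCompact`, `mfderiv_injective_of_pullbackClause`: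
  used as stated inside stubs 1, 2, 3. `π₂(M) = 0` (no `_false_without_` yet) is used ONCE, in the apex
  (one-component count / energy of null-homotopic spheres). No `-- Targets`, no landed Negative lemma
  for this crux (nothing to import); `ledger negatives --problem SmoothPoincare4` = 0.
-/

noncomputable section

-- the prescribed namespace `Summit.<P>.<Sub>.…` duplicates `SmoothPoincare4` (P = Sub)
set_option linter.dupNamespace false

open scoped Manifold ContDiff Topology
open Set TopologicalSpace Literature.Geometry.Kaehler Literature.Geometry.Symplectic

namespace Summit.SmoothPoincare4.SmoothPoincare4.Cruxes.GromovRecognitionRelEnd.CrossCapLaurent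

/-- Model space `ℝ⁴ = ℂ²` (coordinates `0,1` = `z₁`, `2,3` = `z₂`). -/
local notation "E4" => EuclideanSpace ℝ (Fin 4)
/-- `ℝ² = ℂ`, the coordinate plane of one factor. -/
local notation "E2" => EuclideanSpace ℝ (Fin 2)

/-! ## The crux, block form (definitional repackaging used only by the sanity lemma below) -/

/-- The route decl is the Literature named fact, definitionally (Disproof `crux_iff_literature`). -/
theorem crux_iff_literature :
    Summit.SmoothPoincare4.SmoothPoincare4.Theses.SymplecticOrigami.GromovRecognitionRelEnd ↔
      gromov_recognitionR4_relEnd :=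
  Iff.rfl

/-! ## Registered stubs

Conventions inside the signatures (no local definitions are used, so that a stub worker can restate
each signature verbatim in a `Theorems/` file importing only the route):
* `WithLp.toLp 2 ![-(q 1), q 0, -(q 3), q 2]` is `(i ⊕ i) q`, the standard complex structure of
  `ℂ² = ℝ⁴` matched to `stdSymplecticForm` (`ω₀(q, (i⊕i) q) = ‖q‖²`);
* `WithLp.toLp 2 ![p 0 / (p 0 ^ 2 + p 1 ^ 2), -(p 1) / (p 0 ^ 2 + p 1 ^ 2), p 2, p 3]` is the
  COMPLEX inversion of the first factor `(u, z₂) ↦ (1/u, z₂)` (holomorphic, so `i ⊕ i` is preserved),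
  and symmetrically in the second factor;
* the cap-chart domains are `{|u| < R₁⁻¹}` written as `p 0 ^ 2 + p 1 ^ 2 < R₁⁻¹ ^ 2`, etc.;
* "`J = ψ*(i ⊕ i)` beyond `R₁`" is the clause
  `∀ x ∈ Kᶜ, R₁ < ‖ψ x‖ → dψ (J v) = (i ⊕ i)(dψ v)`.
-/

/-- **Stub 1 — the end does not return (S mathematically / M formally; the panel's COMMON FINDING,
triage r1-2 and r1-3 §A4, = Disproof `resists` bullet 1).**  Under the end hypotheses of the crux
(`sf` a smooth 2-form equal to `ψ*ω₀` on `Kᶜ`, `ψ|Kᶜ` a smooth bijection onto `{R < ‖z‖}` with smooth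
inverse `χ`, all sub-ends co-compact), for every `R' > R` the truncation `K ∪ {x ∈ Kᶜ | ‖ψ x‖ < R'}` is
OPEN in `M`; equivalently `χ {R' ≤ ‖w‖}` is closed in `M`, i.e. no sequence `χ wₙ` with `‖wₙ‖ → ∞`
accumulates at a point of `K`.  Proof plan: `K` is compact (`isCompact_of_endsCoCompact`) and closed;
take a compact neighbourhood `N` of `K` (`M` is locally compact); `O := ψ '' (interior N ∖ K)` is open in
`ℝ⁴` with `frontier O ⊆ closedBall 0 R ∪ ψ '' (frontier N)` (a boundary point `w*` with `R < ‖w*‖` is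
`ψ` of `χ w* ∈ N ∖ interior N`, by continuity of `χ`), a compact set; the connected far region
`{T < ‖w‖}` misses it, so lies inside `O` or inside `(closure O)ᶜ`.  Inside `(closure O)ᶜ`: an
accumulating sequence is eventually in `interior N ∖ K`, so `ψ` of it is in `O` — contradiction.
Inside `O`: `χ {T < ‖w‖} ⊆ N`, and a VOLUME count kills it — cover `N` by finitely many compact chart
pieces on which the chart matrix of the continuous `sf` is bounded, so `F := chart ∘ χ` (injective,
smooth, `F*(sf) = ω₀` by H10, hence `|det DF| ≥ c > 0`) maps pieces of `{T < ‖w‖}` of total INFINITE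
Lebesgue measure into bounded chart images with `c · Leb ≤ Leb ∘ F`
(`MeasureTheory.lintegral_abs_det_fderiv_eq_addHaar_image`) — contradiction.  Neither `π₂`, closedness
nor non-degeneracy of `sf` is needed (a degenerate `sf` only makes `|det DF|` larger).  Honours
Disproof `_false_without_ends`: on the shear end `Ω = {0 < y₁, 1 < ‖ψ‖}` the conclusion is false
(`χ(0, t, ρ, 0) → (0, 0, ρ, 0) ∈ K` as `t → 0⁺`), as it must be.  Leans on: `isCompact_of_endsCoCompact`,
`isClosed_of_endsCoCompact` (Disproof §2, to be re-proved in the Theorems file or vendored),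
`ChartedSpace.locallyCompactSpace`, Mathlib Jacobian change of variables, `MForm.inChart` API
(ManifoldForms). [folklore] -/
theorem stub_endDoesNotReturn :
    ∀ (M : Type) [TopologicalSpace M] [T2Space M] [SecondCountableTopology M]
      [ChartedSpace E4 M] [IsManifold (𝓡 4) ∞ M]
      (sf : MForm (𝓡 4) M ℝ 2) (K : Set M) (R : ℝ) (ψ : M → E4) (χ : E4 → M),
      IsSmoothForm sf →
      (∀ R', R ≤ R' → IsCompact (K ∪ {x | ‖ψ x‖ ≤ R'})) →
      ContMDiffOn (𝓡 4) 𝓘(ℝ, E4) ∞ ψ Kᶜ →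
      ContMDiffOn 𝓘(ℝ, E4) (𝓡 4) ∞ χ (Metric.closedBall (0 : E4) R)ᶜ →
      Set.BijOn ψ Kᶜ (Metric.closedBall (0 : E4) R)ᶜ →
      (∀ x, x ∈ Kᶜ → χ (ψ x) = x) →
      (∀ x, x ∈ Kᶜ → ∀ v w, sf x ![v, w] =
        stdSymplecticForm (mfderiv (𝓡 4) 𝓘(ℝ, E4) ψ x v) (mfderiv (𝓡 4) 𝓘(ℝ, E4) ψ x w)) →
      ∀ R', R < R' → IsOpen (K ∪ {x | x ∈ Kᶜ ∧ ‖ψ x‖ < R'}) := by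
  sorry

/-- **Stub 2 — an `sf`-tame `J`, integrable (`= ψ*(i ⊕ i)`) on a sub-end (M mathematically / L
formally; Wendl 2018 Exercise 6.7 p. 137 and McDuff–Salamon 2017 §4.1 "the space of tame `J` is
contractible and non-empty", made relative to the end).**  There are `R₁ > max R 0` and a `C^∞`
almost complex structure `J` on `M`, tamed by `sf`, with `dψ ∘ J = (i ⊕ i) ∘ dψ` at every point of the
sub-end `{x ∈ Kᶜ | R₁ < ‖ψ x‖}`.  Proof plan: `K` is closed (`isClosed_of_endsCoCompact`), so `Kᶜ` is
open and `J₀ := (dψ)⁻¹ (i⊕i) dψ` is a smooth `sf`-COMPATIBLE structure there (H10: `sf = ψ*ω₀`,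
`dψ` injective by `mfderiv_injective_of_pullbackClause`, and `i ⊕ i` is THE `ω₀`-compatible structure
of the Euclidean metric: `ω₀(q, (i⊕i) q') = ⟪q, q'⟫`); pick `R < R₁' < R₁`; by Stub 1's conclusion
(hypothesis here) `closure {R₁ ≤ ‖ψ‖} ⊆ {R₁' < ‖ψ‖}`, so a smooth partition of unity glues the
metric `ψ*g_eucl` on `{R₁' < ‖ψ‖}` with any Riemannian metric on `M` (charts + `SmoothPartitionOfUnity`,
`exists_smooth_forall_mem_convex_of_local`); the polar decomposition `J_g := A (−A²)^{-1/2}`,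
`A := g⁻¹ sf`, is smooth (real-analytic functional calculus on the open set of `g`-skew invertible
`A`), `sf`-compatible hence tame (MS2017 Prop. 2.5.6 / (4.1.3)), and equals `J₀` where `g = ψ*g_eucl`
and `sf = ψ*ω₀`.  Why `R₁ > R` strictly: Disproof §7 (`TwistEnd`: `ψ*(i⊕i)` blows up at `∂K`).  Formal
cost: the `ContMDiff` section condition of `AlmostComplexStructure` (hom-bundle smoothness, cf.
`AlmostComplexStructure.ofModel`) for a non-constant `J`, and smoothness of the matrix square root.
Honours `_false_without_pullback` (H10 is what makes `J₀` tame) and `_false_without_nondegenerate`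
(no tame `J` exists for a degenerate `sf`). Leans on: `AlmostComplexStructure`, `.IsTamedBy`,
`.IsCompatibleWith`, `isCompatibleWith_iff`, `stdSymplecticForm`, Mathlib `SmoothPartitionOfUnity`,
`Matrix.IsHermitian`/CFC square roots. [cite: McDuffSalamon2017, §4.1; Wendl2018, Exercise 6.7] -/
theorem stub_tameJ :
    ∀ (M : Type) [TopologicalSpace M] [T2Space M] [SecondCountableTopology M]
      [ChartedSpace E4 M] [IsManifold (𝓡 4) ∞ M]
      (sf : MForm (𝓡 4) M ℝ 2) (K : Set M) (R : ℝ) (ψ : M → E4),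
      IsSmoothForm sf →
      (∀ x (v : TangentSpace (𝓡 4) x), v ≠ 0 → ∃ w, sf x ![v, w] ≠ 0) →
      (∀ R', R ≤ R' → IsCompact (K ∪ {x | ‖ψ x‖ ≤ R'})) →
      ContMDiffOn (𝓡 4) 𝓘(ℝ, E4) ∞ ψ Kᶜ →
      Set.BijOn ψ Kᶜ (Metric.closedBall (0 : E4) R)ᶜ →
      (∀ x, x ∈ Kᶜ → ∀ v w, sf x ![v, w] =
        stdSymplecticForm (mfderiv (𝓡 4) 𝓘(ℝ, E4) ψ x v) (mfderiv (𝓡 4) 𝓘(ℝ, E4) ψ x w)) →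
      (∀ R', R < R' → IsOpen (K ∪ {x | x ∈ Kᶜ ∧ ‖ψ x‖ < R'})) →
      ∃ (R₁ : ℝ) (J : AlmostComplexStructure (𝓡 4) ∞ M), R < R₁ ∧ 0 < R₁ ∧ J.IsTamedBy sf ∧
        ∀ x, x ∈ Kᶜ → R₁ < ‖ψ x‖ → ∀ (v : TangentSpace (𝓡 4) x) (a : E4),
          a = mfderiv (𝓡 4) 𝓘(ℝ, E4) ψ x v →
          mfderiv (𝓡 4) 𝓘(ℝ, E4) ψ x (J x v) = WithLp.toLp 2 ![-(a 1), a 0, -(a 3), a 2] := by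
  sorry

/-- **Stub 3 — the WEDGE CAP (L; card S1 `CapExists`, triage r1-3 §A5 "sum-type, bent form" — fine for
the `J`-curve line).**  Given the end data, Stub 1's openness, and a tame `J` equal to `ψ*(i ⊕ i)`
beyond `R₁ > max R 0`, there is a closed model: a compact connected Hausdorff second-countable smooth
4-manifold `X` with
* a closed smooth 2-form `ωX` and a `C^∞` almost complex structure `JX` TAMED by `ωX`;
* an injective local diffeomorphism `ι : M → X` which is `(J, JX)`-holomorphic (`JX ∘ dι = dι ∘ J`);
* three CAP CHARTS `ηV, ηH, ηC : ℝ⁴ → X` — injective local diffeomorphisms on the polydiscs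
  `{|u| < R₁⁻¹} × ℂ`, `ℂ × {|t| < R₁⁻¹}`, `{|u| < R₁⁻¹} × {|t| < R₁⁻¹}` — GLUED to the end by
  `ηV (u, z₂) = ι χ (1/u, z₂)` (`u ≠ 0`), `ηH (z₁, t) = ι χ (z₁, 1/t)` (`t ≠ 0`), `ηC = ηV ∘ (t ↦ 1/t) =
  ηH ∘ (u ↦ 1/u)` off the axes, whose axis points `ηV (0, z₂)`, `ηH (z₁, 0)`, `ηC 0` are NEW (not in
  `ι(M)`: the spheres at infinity `V∞ = {z₁ = ∞}`, `H∞ = {z₂ = ∞}` and their corner), in which `JX` is the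
  product structure `i ⊕ i` (complex inversion is holomorphic), and which together with `ι(M)` COVER `X`.
Construction (the prover's): `X := M ⊕ (ℂ ⊕ ℂ ⊕ pt)` as a type with the topology/`ChartedSpace`
generated by `ι`-charts and the three `η`-charts (transition maps `η⁻¹ ∘ ι ∘ chart = inversion ∘ ψ ∘ chart`,
smooth); Hausdorff BY STUB 1 (a wedge point and a point of `K` are separated because
`K ∪ {‖ψ‖ < R'}` is open with compact closure disjoint from `χ{‖w‖∞ > R'}`), compact by H5
(`X = (K ∪ {‖ψ‖ ≤ T}) ∪` closures of the three polydisc images), connected since `M` is dense;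
`JX := ι_*J` on `ι(M)` (`= i ⊕ i` beyond `R₁` by Stub 2, so it glues to `i ⊕ i` in the cap charts);
`ωX := ι_*sf` on `ι(K ∪ χ{|z₁|,|z₂| < ρ₀})` and `ψ*(τ ⊕ τ)` beyond, `ρ₀ > R₁` the FORM-MODIFICATION
RADIUS (triage r1-2: explicit, and irrelevant downstream because the endgame uses `sf`, never `ωX`),
`τ = f(|z|²) dx∧dy` a radial area form with `f ≡ 1` on `[0, ρ₀²]`, `f(s) = c/s²` for large `s` (so
`τ` extends smoothly and positively over `z = ∞`: in `u = 1/z`, `f(|u|⁻²)|u|⁻⁴ du-area → c`), which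
agrees with `sf = ψ*ω₀` on the overlap (H10) and tames `i ⊕ i` (`f > 0`) and `J` (where `ωX = sf`).
Symplectic areas of `H∞`, `V∞` are finite and equal (`= ∫ τ`), not recorded (the apex uses the
one-component count, not energy-minimality).  Honours `_false_without_ends` (no compact `X` on the
shear end), `_false_without_pullback` (the gluing of `ωX` and the tameness of `ψ*(i⊕i)` need `ψ`
symplectic).  Formal cost: building a `ChartedSpace`/`IsManifold` structure on a sum type (no Mathlib
API for gluing) — the ugliest but elementary step. Leans on: `PartialHomeomorph`/`PartialDiffeomorph`,
`IsLocalDiffeomorph`, `AlmostComplexStructure.ofModel` (cap charts), `MForm.pullback`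
(`stdSymplecticMForm_pullback_apply`, `isClosedForm_stdSymplecticMForm_pullback`), Stub 1.
[cite: McDuffSalamon2017, Rem. 4.5.2 (v); Wendl2018, Thm 6.8; Gromov1985, §0.3.C] -/
theorem stub_capModel :
    ∀ (M : Type) [TopologicalSpace M] [T2Space M] [SecondCountableTopology M]
      [ChartedSpace E4 M] [IsManifold (𝓡 4) ∞ M] [ConnectedSpace M]
      (sf : MForm (𝓡 4) M ℝ 2) (K : Set M) (R : ℝ) (ψ : M → E4) (χ : E4 → M),
      IsSmoothForm sf → IsClosedForm sf →
      (∀ x (v : TangentSpace (𝓡 4) x), v ≠ 0 → ∃ w, sf x ![v, w] ≠ 0) →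
      (∀ R', R ≤ R' → IsCompact (K ∪ {x | ‖ψ x‖ ≤ R'})) →
      ContMDiffOn (𝓡 4) 𝓘(ℝ, E4) ∞ ψ Kᶜ →
      ContMDiffOn 𝓘(ℝ, E4) (𝓡 4) ∞ χ (Metric.closedBall (0 : E4) R)ᶜ →
      Set.BijOn ψ Kᶜ (Metric.closedBall (0 : E4) R)ᶜ →
      (∀ x, x ∈ Kᶜ → χ (ψ x) = x) →
      (∀ x, x ∈ Kᶜ → ∀ v w, sf x ![v, w] =
        stdSymplecticForm (mfderiv (𝓡 4) 𝓘(ℝ, E4) ψ x v) (mfderiv (𝓡 4) 𝓘(ℝ, E4) ψ x w)) →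
      (∀ R', R < R' → IsOpen (K ∪ {x | x ∈ Kᶜ ∧ ‖ψ x‖ < R'})) →
      ∀ (R₁ : ℝ) (J : AlmostComplexStructure (𝓡 4) ∞ M), R < R₁ → 0 < R₁ → J.IsTamedBy sf →
      (∀ x, x ∈ Kᶜ → R₁ < ‖ψ x‖ → ∀ (v : TangentSpace (𝓡 4) x) (a : E4),
          a = mfderiv (𝓡 4) 𝓘(ℝ, E4) ψ x v →
          mfderiv (𝓡 4) 𝓘(ℝ, E4) ψ x (J x v) = WithLp.toLp 2 ![-(a 1), a 0, -(a 3), a 2]) →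
      ∃ (X : Type) (_ : TopologicalSpace X) (_ : T2Space X) (_ : SecondCountableTopology X)
        (_ : CompactSpace X) (_ : ConnectedSpace X) (_ : ChartedSpace E4 X) (_ : IsManifold (𝓡 4) ∞ X)
        (ωX : MForm (𝓡 4) X ℝ 2) (JX : AlmostComplexStructure (𝓡 4) ∞ X) (ι : M → X)
        (ηH ηV ηC : E4 → X),
        (IsSmoothForm ωX ∧ IsClosedForm ωX ∧ JX.IsTamedBy ωX) ∧
        (IsLocalDiffeomorph (𝓡 4) (𝓡 4) ∞ ι ∧ Function.Injective ι ∧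
          ∀ (x : M) (v : TangentSpace (𝓡 4) x),
            JX (ι x) (mfderiv (𝓡 4) (𝓡 4) ι x v) = mfderiv (𝓡 4) (𝓡 4) ι x (J x v)) ∧
        (IsLocalDiffeomorphOn 𝓘(ℝ, E4) (𝓡 4) ∞ ηV {p : E4 | p 0 ^ 2 + p 1 ^ 2 < R₁⁻¹ ^ 2} ∧
          Set.InjOn ηV {p : E4 | p 0 ^ 2 + p 1 ^ 2 < R₁⁻¹ ^ 2} ∧
          (∀ p : E4, p 0 ^ 2 + p 1 ^ 2 < R₁⁻¹ ^ 2 → (p 0 ≠ 0 ∨ p 1 ≠ 0) →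
            ηV p = ι (χ (WithLp.toLp 2
              ![p 0 / (p 0 ^ 2 + p 1 ^ 2), -(p 1) / (p 0 ^ 2 + p 1 ^ 2), p 2, p 3]))) ∧
          (∀ p : E4, p 0 = 0 → p 1 = 0 → ηV p ∉ Set.range ι) ∧
          (∀ p : E4, p 0 ^ 2 + p 1 ^ 2 < R₁⁻¹ ^ 2 → ∀ q : E4,
            JX (ηV p) (mfderiv 𝓘(ℝ, E4) (𝓡 4) ηV p q) =
              mfderiv 𝓘(ℝ, E4) (𝓡 4) ηV p (WithLp.toLp 2 ![-(q 1), q 0, -(q 3), q 2]))) ∧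
        (IsLocalDiffeomorphOn 𝓘(ℝ, E4) (𝓡 4) ∞ ηH {p : E4 | p 2 ^ 2 + p 3 ^ 2 < R₁⁻¹ ^ 2} ∧
          Set.InjOn ηH {p : E4 | p 2 ^ 2 + p 3 ^ 2 < R₁⁻¹ ^ 2} ∧
          (∀ p : E4, p 2 ^ 2 + p 3 ^ 2 < R₁⁻¹ ^ 2 → (p 2 ≠ 0 ∨ p 3 ≠ 0) →
            ηH p = ι (χ (WithLp.toLp 2
              ![p 0, p 1, p 2 / (p 2 ^ 2 + p 3 ^ 2), -(p 3) / (p 2 ^ 2 + p 3 ^ 2)]))) ∧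
          (∀ p : E4, p 2 = 0 → p 3 = 0 → ηH p ∉ Set.range ι) ∧
          (∀ p : E4, p 2 ^ 2 + p 3 ^ 2 < R₁⁻¹ ^ 2 → ∀ q : E4,
            JX (ηH p) (mfderiv 𝓘(ℝ, E4) (𝓡 4) ηH p q) =
              mfderiv 𝓘(ℝ, E4) (𝓡 4) ηH p (WithLp.toLp 2 ![-(q 1), q 0, -(q 3), q 2]))) ∧
        (IsLocalDiffeomorphOn 𝓘(ℝ, E4) (𝓡 4) ∞ ηC
            {p : E4 | p 0 ^ 2 + p 1 ^ 2 < R₁⁻¹ ^ 2 ∧ p 2 ^ 2 + p 3 ^ 2 < R₁⁻¹ ^ 2} ∧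
          Set.InjOn ηC {p : E4 | p 0 ^ 2 + p 1 ^ 2 < R₁⁻¹ ^ 2 ∧ p 2 ^ 2 + p 3 ^ 2 < R₁⁻¹ ^ 2} ∧
          (∀ p : E4, p 0 ^ 2 + p 1 ^ 2 < R₁⁻¹ ^ 2 → p 2 ^ 2 + p 3 ^ 2 < R₁⁻¹ ^ 2 →
            (p 2 ≠ 0 ∨ p 3 ≠ 0) →
            ηC p = ηV (WithLp.toLp 2
              ![p 0, p 1, p 2 / (p 2 ^ 2 + p 3 ^ 2), -(p 3) / (p 2 ^ 2 + p 3 ^ 2)])) ∧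
          (∀ p : E4, p 0 ^ 2 + p 1 ^ 2 < R₁⁻¹ ^ 2 → p 2 ^ 2 + p 3 ^ 2 < R₁⁻¹ ^ 2 →
            (p 0 ≠ 0 ∨ p 1 ≠ 0) →
            ηC p = ηH (WithLp.toLp 2
              ![p 0 / (p 0 ^ 2 + p 1 ^ 2), -(p 1) / (p 0 ^ 2 + p 1 ^ 2), p 2, p 3])) ∧
          ηC 0 ∉ Set.range ι ∧
          (∀ p : E4, p 0 ^ 2 + p 1 ^ 2 < R₁⁻¹ ^ 2 → p 2 ^ 2 + p 3 ^ 2 < R₁⁻¹ ^ 2 → ∀ q : E4,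
            JX (ηC p) (mfderiv 𝓘(ℝ, E4) (𝓡 4) ηC p q) =
              mfderiv 𝓘(ℝ, E4) (𝓡 4) ηC p (WithLp.toLp 2 ![-(q 1), q 0, -(q 3), q 2]))) ∧
        (∀ y : X, y ∈ Set.range ι ∨ (∃ p : E4, p 0 ^ 2 + p 1 ^ 2 < R₁⁻¹ ^ 2 ∧ ηV p = y) ∨
          (∃ p : E4, p 2 ^ 2 + p 3 ^ 2 < R₁⁻¹ ^ 2 ∧ ηH p = y) ∨
          (∃ p : E4, (p 0 ^ 2 + p 1 ^ 2 < R₁⁻¹ ^ 2 ∧ p 2 ^ 2 + p 3 ^ 2 < R₁⁻¹ ^ 2) ∧ ηC p = y)) := by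
  sorry

/-- **Stub 4 — THE APEX: Gromov–McDuff bi-foliation of the wedge cap, read on `M` (XL; card S3
`TwoJFibrations` + S2 `SphericalClasses`/`AreaQuantisation` absorbed as its `π₂` hypothesis; = the
panel's "Theorem E′": Wendl 2018 Thm E = Thm 6.8, held copy pp. 21, 137–139, McDuff–Salamon 2017
Rem. 4.5.2 (v) p. 192 [470, Thm 9.4.7], with the one-component count of wedge-pencils (c) / this card's
index count replacing minimality AND genericity).**  Let `M` be a connected 4-manifold with an almost
complex structure `J`, an end chart `ψ : Kᶜ ≅ {R < ‖z‖}` (inverse `χ`) on which `J = ψ*(i ⊕ i)` beyond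
`R₁ > max R 0`, with `π₂(M) = 0`, and let `(X, ωX, JX, ι, ηH, ηV, ηC)` be a wedge cap of `(M, J)` as
output by Stub 3.  Then there is a diffeomorphism `σ : M ≃ₘ ℝ⁴ = ℂ²` (the restriction to
`ι(M) = X ∖ (H∞ ∪ V∞)` of the bi-foliation chart `σ_X = (π_V, π_H) : X → ℂP¹ × ℂP¹`, each leaf labelled
by its intersection with the OTHER sphere at infinity in the cap coordinates) such that
(B1, SPLIT) `J` preserves both coordinate distributions `dσ⁻¹(ℂ × 0)`, `dσ⁻¹(0 × ℂ)` (their leaves are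
the `J`-holomorphic spheres minus a point); (B2, TAME) `ω₀(dσ v, dσ (J v)) > 0` for `v ≠ 0` (split +
ORIENTATION: `dσ|leaf` is complex-orientation-preserving, the sign being locally constant on the
connected `E_H ∖ 0`, `E_V ∖ 0` and `+` at the flat leaves — then the kernel-checked pointwise
`tameSplit`; triage r1-3's orientation clause); (B3, FLAT LEAVES) `σ₁ ∘ χ = z₁` wherever `|z₁| > R₁` and
`σ₂ ∘ χ = z₂` wherever `|z₂| > R₁` — the flat lines `{z₁ = c}`, `{z₂ = c}`, `|c| > R₁`, closed up at
`ηH(c, 0)`, `ηV(0, c)`, ARE `JX`-spheres of the two families (they lie where `JX = i ⊕ i`) and the member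
through a point is unique (positivity of intersections, `[V]² = [H]² = 0`) — so `σ = ψ` EXACTLY on the
corner region `{|z₁| > R₁, |z₂| > R₁}`; (B4/B5, SMOOTH AT THE WEDGE) in the cap chart `(u, z₂) =
(1/z₁, z₂)` the second coordinate `z₂ ∘ σ ∘ χ (1/u, z₂)` extends SMOOTHLY across `u = 0` by `z₂`
(this is `σ_X` smooth with `σ_X = id` on `V∞`; its Taylor expansion in `u` is the Laurent tail
`G_b(z₁) = b + β₁(b)/z₁ + …` of the non-flat leaves, card S4), and symmetrically at `H∞`.
Proof plan (Wendl pp. 138–139 made relative and non-generic): `H∞ = ηH(ℂ × 0) ∪ {ηC 0}` and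
`V∞ = ηV(0 × ℂ) ∪ {ηC 0}` are embedded `JX`-holomorphic spheres with trivial normal bundles meeting once
transversally (read off the cap charts); automatic transversality for embedded index-2 spheres with
`c_N = 0` (Wendl Thm 2.44/2.46, Prop 2.53: nearby curves foliate) gives smooth 2-dimensional moduli
spaces `𝓜_H`, `𝓜_V` through `H∞`, `V∞` for the NON-generic `JX`; COMPACTNESS with no genericity: in
a Gromov limit of `[H]`-spheres every component missing `H∞ ∪ V∞` is a sphere in `ι(M) ≃ M`, hence
null-homotopic (`π₂(M) = 0`, used HERE and only here), hence of zero `ωX`-area (Stokes for the closed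
`ωX`), hence constant; positivity of intersections with the `JX`-holomorphic `H∞`, `V∞` forces the
remaining components to have `(·H∞, ·V∞) ≥ 0` summing to `(0, 1)`: exactly ONE non-constant component,
simple (primitive class), embedded (adjunction `0 = 2δ + c₁ − 2`), regular — no bubbling, no nodal
curves (equivalently: this card's `SphericalClasses`, Hurewicz image `ℤH ⊕ ℤV` in the universal cover,
or Wendl's index count `ind = −2 + 4k + 4m > 0` feeding his Thm 4.6); then `[H]·[H] = 0`, `[H]·[V] = 1`
and positivity make `(π_V, π_H)` a diffeomorphism `X → 𝓜_V × 𝓜_H ≅ ℂP¹ × ℂP¹` (Wendl Thm F argument,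
`m = 0`), which is the identity on the wedge in the labels chosen; restrict to `ι(M)`.  Only tameness
of `JX` by the closed `ωX` is used on `X` (energy bounds), never genericity.  NOT a restatement of the
crux: the conclusion is a bi-foliation chart with two inequalities and an asymptotic, not a
symplectomorphism; `σ ≠ ψ` on the slabs `{|z₂| ≤ R₁}`, `{|z₁| ≤ R₁}` in general (ruled-cap's conic
`(z₂ − c)(z₁ − w₀) = δ`).  Formal cost: Fredholm/automatic transversality, Gromov compactness for
embedded spheres of bounded energy (Hummel 1997, held), positivity of intersections + adjunction
(McDuff, Micallef–White; Wendl Thms 2.49/2.51), smooth structure on moduli spaces — nothing of it in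
Mathlib (XL).  Leans on: `AlmostComplexStructure`, `IsJHolomorphic`,
`IsJHolomorphic.pullback_apply_pair_pos` (energy density), `jSphere_const_of_exact_tame` (model of the
zero-area step), `tameSplit` (SketchIdeator2, to be re-landed with `--supports`), `HomotopyGroup.Pi`.
[cite: Wendl2018, Thm 6.8; McDuffSalamon2017, Rem. 4.5.2 (v),(viii); Gromov1985, §0.3.C, 2.4.A₁] -/
theorem stub_biFoliation :
    ∀ (M : Type) [TopologicalSpace M] [T2Space M] [SecondCountableTopology M]
      [ChartedSpace E4 M] [IsManifold (𝓡 4) ∞ M] [ConnectedSpace M]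
      (J : AlmostComplexStructure (𝓡 4) ∞ M) (K : Set M) (R R₁ : ℝ) (ψ : M → E4) (χ : E4 → M),
      (∀ x : M, Subsingleton (π_ 2 M x)) →
      ContMDiffOn (𝓡 4) 𝓘(ℝ, E4) ∞ ψ Kᶜ →
      ContMDiffOn 𝓘(ℝ, E4) (𝓡 4) ∞ χ (Metric.closedBall (0 : E4) R)ᶜ →
      Set.BijOn ψ Kᶜ (Metric.closedBall (0 : E4) R)ᶜ →
      (∀ x, x ∈ Kᶜ → χ (ψ x) = x) →
      R < R₁ → 0 < R₁ →
      (∀ x, x ∈ Kᶜ → R₁ < ‖ψ x‖ → ∀ (v : TangentSpace (𝓡 4) x) (a : E4),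
          a = mfderiv (𝓡 4) 𝓘(ℝ, E4) ψ x v →
          mfderiv (𝓡 4) 𝓘(ℝ, E4) ψ x (J x v) = WithLp.toLp 2 ![-(a 1), a 0, -(a 3), a 2]) →
      ∀ (X : Type) [TopologicalSpace X] [T2Space X] [SecondCountableTopology X] [CompactSpace X]
        [ConnectedSpace X] [ChartedSpace E4 X] [IsManifold (𝓡 4) ∞ X]
        (ωX : MForm (𝓡 4) X ℝ 2) (JX : AlmostComplexStructure (𝓡 4) ∞ X) (ι : M → X)
        (ηH ηV ηC : E4 → X),
        (IsSmoothForm ωX ∧ IsClosedForm ωX ∧ JX.IsTamedBy ωX) ∧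
        (IsLocalDiffeomorph (𝓡 4) (𝓡 4) ∞ ι ∧ Function.Injective ι ∧
          ∀ (x : M) (v : TangentSpace (𝓡 4) x),
            JX (ι x) (mfderiv (𝓡 4) (𝓡 4) ι x v) = mfderiv (𝓡 4) (𝓡 4) ι x (J x v)) ∧
        (IsLocalDiffeomorphOn 𝓘(ℝ, E4) (𝓡 4) ∞ ηV {p : E4 | p 0 ^ 2 + p 1 ^ 2 < R₁⁻¹ ^ 2} ∧
          Set.InjOn ηV {p : E4 | p 0 ^ 2 + p 1 ^ 2 < R₁⁻¹ ^ 2} ∧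
          (∀ p : E4, p 0 ^ 2 + p 1 ^ 2 < R₁⁻¹ ^ 2 → (p 0 ≠ 0 ∨ p 1 ≠ 0) →
            ηV p = ι (χ (WithLp.toLp 2
              ![p 0 / (p 0 ^ 2 + p 1 ^ 2), -(p 1) / (p 0 ^ 2 + p 1 ^ 2), p 2, p 3]))) ∧
          (∀ p : E4, p 0 = 0 → p 1 = 0 → ηV p ∉ Set.range ι) ∧
          (∀ p : E4, p 0 ^ 2 + p 1 ^ 2 < R₁⁻¹ ^ 2 → ∀ q : E4,
            JX (ηV p) (mfderiv 𝓘(ℝ, E4) (𝓡 4) ηV p q) =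
              mfderiv 𝓘(ℝ, E4) (𝓡 4) ηV p (WithLp.toLp 2 ![-(q 1), q 0, -(q 3), q 2]))) ∧
        (IsLocalDiffeomorphOn 𝓘(ℝ, E4) (𝓡 4) ∞ ηH {p : E4 | p 2 ^ 2 + p 3 ^ 2 < R₁⁻¹ ^ 2} ∧
          Set.InjOn ηH {p : E4 | p 2 ^ 2 + p 3 ^ 2 < R₁⁻¹ ^ 2} ∧
          (∀ p : E4, p 2 ^ 2 + p 3 ^ 2 < R₁⁻¹ ^ 2 → (p 2 ≠ 0 ∨ p 3 ≠ 0) →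
            ηH p = ι (χ (WithLp.toLp 2
              ![p 0, p 1, p 2 / (p 2 ^ 2 + p 3 ^ 2), -(p 3) / (p 2 ^ 2 + p 3 ^ 2)]))) ∧
          (∀ p : E4, p 2 = 0 → p 3 = 0 → ηH p ∉ Set.range ι) ∧
          (∀ p : E4, p 2 ^ 2 + p 3 ^ 2 < R₁⁻¹ ^ 2 → ∀ q : E4,
            JX (ηH p) (mfderiv 𝓘(ℝ, E4) (𝓡 4) ηH p q) =
              mfderiv 𝓘(ℝ, E4) (𝓡 4) ηH p (WithLp.toLp 2 ![-(q 1), q 0, -(q 3), q 2]))) ∧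
        (IsLocalDiffeomorphOn 𝓘(ℝ, E4) (𝓡 4) ∞ ηC
            {p : E4 | p 0 ^ 2 + p 1 ^ 2 < R₁⁻¹ ^ 2 ∧ p 2 ^ 2 + p 3 ^ 2 < R₁⁻¹ ^ 2} ∧
          Set.InjOn ηC {p : E4 | p 0 ^ 2 + p 1 ^ 2 < R₁⁻¹ ^ 2 ∧ p 2 ^ 2 + p 3 ^ 2 < R₁⁻¹ ^ 2} ∧
          (∀ p : E4, p 0 ^ 2 + p 1 ^ 2 < R₁⁻¹ ^ 2 → p 2 ^ 2 + p 3 ^ 2 < R₁⁻¹ ^ 2 →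
            (p 2 ≠ 0 ∨ p 3 ≠ 0) →
            ηC p = ηV (WithLp.toLp 2
              ![p 0, p 1, p 2 / (p 2 ^ 2 + p 3 ^ 2), -(p 3) / (p 2 ^ 2 + p 3 ^ 2)])) ∧
          (∀ p : E4, p 0 ^ 2 + p 1 ^ 2 < R₁⁻¹ ^ 2 → p 2 ^ 2 + p 3 ^ 2 < R₁⁻¹ ^ 2 →
            (p 0 ≠ 0 ∨ p 1 ≠ 0) →
            ηC p = ηH (WithLp.toLp 2
              ![p 0 / (p 0 ^ 2 + p 1 ^ 2), -(p 1) / (p 0 ^ 2 + p 1 ^ 2), p 2, p 3])) ∧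
          ηC 0 ∉ Set.range ι ∧
          (∀ p : E4, p 0 ^ 2 + p 1 ^ 2 < R₁⁻¹ ^ 2 → p 2 ^ 2 + p 3 ^ 2 < R₁⁻¹ ^ 2 → ∀ q : E4,
            JX (ηC p) (mfderiv 𝓘(ℝ, E4) (𝓡 4) ηC p q) =
              mfderiv 𝓘(ℝ, E4) (𝓡 4) ηC p (WithLp.toLp 2 ![-(q 1), q 0, -(q 3), q 2]))) ∧
        (∀ y : X, y ∈ Set.range ι ∨ (∃ p : E4, p 0 ^ 2 + p 1 ^ 2 < R₁⁻¹ ^ 2 ∧ ηV p = y) ∨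
          (∃ p : E4, p 2 ^ 2 + p 3 ^ 2 < R₁⁻¹ ^ 2 ∧ ηH p = y) ∨
          (∃ p : E4, (p 0 ^ 2 + p 1 ^ 2 < R₁⁻¹ ^ 2 ∧ p 2 ^ 2 + p 3 ^ 2 < R₁⁻¹ ^ 2) ∧ ηC p = y)) →
        ∃ σ : M ≃ₘ⟮𝓡 4, 𝓡 4⟯ E4,
          (∀ (x : M) (v : TangentSpace (𝓡 4) x) (a b : E4), a = mfderiv (𝓡 4) 𝓘(ℝ, E4) σ x v →
              b = mfderiv (𝓡 4) 𝓘(ℝ, E4) σ x (J x v) →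
              (a 2 = 0 → a 3 = 0 → b 2 = 0 ∧ b 3 = 0) ∧ (a 0 = 0 → a 1 = 0 → b 0 = 0 ∧ b 1 = 0)) ∧
          (∀ (x : M) (v : TangentSpace (𝓡 4) x), v ≠ 0 →
              0 < stdSymplecticForm (mfderiv (𝓡 4) 𝓘(ℝ, E4) σ x v)
                (mfderiv (𝓡 4) 𝓘(ℝ, E4) σ x (J x v))) ∧
          (∀ w : E4, R₁ ^ 2 < w 0 ^ 2 + w 1 ^ 2 → (σ (χ w)) 0 = w 0 ∧ (σ (χ w)) 1 = w 1) ∧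
          (∀ w : E4, R₁ ^ 2 < w 2 ^ 2 + w 3 ^ 2 → (σ (χ w)) 2 = w 2 ∧ (σ (χ w)) 3 = w 3) ∧
          (∃ g : E4 → E2, ContDiffOn ℝ ∞ g {p : E4 | p 0 ^ 2 + p 1 ^ 2 < R₁⁻¹ ^ 2} ∧
            (∀ p q : E4, p 0 ^ 2 + p 1 ^ 2 < R₁⁻¹ ^ 2 → (p 0 ≠ 0 ∨ p 1 ≠ 0) →
              q = σ (χ (WithLp.toLp 2
                ![p 0 / (p 0 ^ 2 + p 1 ^ 2), -(p 1) / (p 0 ^ 2 + p 1 ^ 2), p 2, p 3])) →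
              g p = WithLp.toLp 2 ![q 2, q 3]) ∧
            (∀ p : E4, p 0 = 0 → p 1 = 0 → g p = WithLp.toLp 2 ![p 2, p 3])) ∧
          (∃ h : E4 → E2, ContDiffOn ℝ ∞ h {p : E4 | p 2 ^ 2 + p 3 ^ 2 < R₁⁻¹ ^ 2} ∧
            (∀ p q : E4, p 2 ^ 2 + p 3 ^ 2 < R₁⁻¹ ^ 2 → (p 2 ≠ 0 ∨ p 3 ≠ 0) →
              q = σ (χ (WithLp.toLp 2
                ![p 0, p 1, p 2 / (p 2 ^ 2 + p 3 ^ 2), -(p 3) / (p 2 ^ 2 + p 3 ^ 2)])) →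
              h p = WithLp.toLp 2 ![q 0, q 1]) ∧
            (∀ p : E4, p 2 = 0 → p 3 = 0 → h p = WithLp.toLp 2 ![p 0, p 1])) := by
  sorry

/-- **Stub 5 — Laurent decay and the tame cut-off (M mathematically / L formally; card S4
`LaurentDecay` in its triage form "smoothness at the wedge", + S5 `SmallIsotopyExtension`).**  From the
apex output `σ` (split, tame, flat-leaf exactness (B3), smooth extension at the wedge (B4/B5)) build a
diffeomorphism `Φ₁ : M ≃ₘ ℝ⁴` with `Φ₁ = ψ` off a compact `K₁ ⊇ K` such that `Φ₁*ω₀` STILL tames `J`.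
Proof plan.  DECAY: write `g(u, z₂) − z₂ = u₁ h₁ + u₂ h₂` (Hadamard in the real plane variable `u`, `hᵢ`
smooth); by (B3) `g(u, z₂) = z₂` identically for `|z₂| > R₁`, so on the compact
`{|u| ≤ (2R₁)⁻¹} × {|z₂| ≤ R₁ + 1}` the `hᵢ` and their derivatives are bounded; with `u = 1/z₁`
(`‖D(1/z₁)‖ = |z₁|⁻²`) this gives `‖σ χ w − w‖ ≤ A/|z₁|`, `‖D(σ∘χ)(w) − I‖ ≤ A/|z₁|` on `{|z₁| ≥ 2R₁}`
(and `σ∘χ = id` on `{|z₁| > R₁, |z₂| > R₁}` by both halves of (B3)); symmetrically on `{|z₂| ≥ 2R₁}`; as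
`max(|z₁|, |z₂|) ≥ ‖w‖/√2`, `σ ∘ χ − id → 0` in `C¹` at infinity, at rate `O(1/ρ)` (the card's
`LaurentTailDecay`; no holomorphy is needed for the estimate, only for its interpretation).  CUT-OFF:
`Γ(w) := w + λ(‖w‖)(σ χ w − w)` with `λ = 1` on `[0, 2r₁]`, `λ = 0` on `[3r₁, ∞)`, `|λ'| ≤ 2/r₁`, `r₁`
large: `‖DΓ − I‖ ≤ 3δ` on `{r₁ < ‖w‖}`, `Γ = σ∘χ` on `{R < ‖w‖ ≤ 2r₁}`, `Γ = id` beyond `3r₁`;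
`Φ₁ := σ` on `K ∪ {‖ψ‖ ≤ 2r₁}`, `:= Γ ∘ ψ` on `{r₁ < ‖ψ‖}` (they agree on the open overlap) is a
local diffeomorphism, injective by the two-radius argument (choose `r₁` beyond `sup ‖σ‖` on the compact
`K ∪ {‖ψ‖ ≤ r*}`, triage r1-3 on wedge-pencils; or: proper local diffeo onto the simply connected `ℝ⁴`)
and onto (open and closed image), `Φ₁ = ψ` off `K₁ := K ∪ {‖ψ‖ ≤ 3r₁}` (compact by H5, `⊇ K`).
TAMENESS of `Φ₁*ω₀`: where `Φ₁ = σ` it is (B2); on `{2r₁ < ‖ψ‖}` read in `ψ`-coordinates, where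
`J = i ⊕ i` (`2r₁ > R₁`) and `ω₀(q, (i⊕i)q) = ‖q‖²`: `ω₀((I+E)q, (I+E)(i⊕i)q) ≥ (1 − 3‖E‖)‖q‖² > 0`
for `‖E‖ ≤ 3δ < 1/9`.  Honours `_false_without_ends` (H5 makes `K₁` compact), `_false_without_pullback`
(H10 is how `sf`-tameness of `J` and `J = i ⊕ i` in `ψ`-coordinates cohere), §7 `TwistEnd` (`K₁ ⊋ K`).
Leans on: Mathlib `ContDiffBump`/`Real.smoothTransition` (cut-off), `Diffeomorph`,
`IsLocalDiffeomorph.diffeomorphOfBijective` (packaging), `fderiv` norm estimates, Hadamard's lemma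
(to write: `exists_smooth_factor_of_vanishes`), H5. [folklore; cite: McDuffSalamon2017, Rem. 4.5.2 (viii)
"coordinates for a diffeomorphism to ℝ⁴"] -/
theorem stub_flatCutoff :
    ∀ (M : Type) [TopologicalSpace M] [T2Space M] [SecondCountableTopology M]
      [ChartedSpace E4 M] [IsManifold (𝓡 4) ∞ M] [ConnectedSpace M]
      (sf : MForm (𝓡 4) M ℝ 2) (K : Set M) (R : ℝ) (ψ : M → E4) (χ : E4 → M),
      (∀ R', R ≤ R' → IsCompact (K ∪ {x | ‖ψ x‖ ≤ R'})) →
      ContMDiffOn (𝓡 4) 𝓘(ℝ, E4) ∞ ψ Kᶜ →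
      ContMDiffOn 𝓘(ℝ, E4) (𝓡 4) ∞ χ (Metric.closedBall (0 : E4) R)ᶜ →
      Set.BijOn ψ Kᶜ (Metric.closedBall (0 : E4) R)ᶜ →
      (∀ x, x ∈ Kᶜ → χ (ψ x) = x) →
      (∀ x, x ∈ Kᶜ → ∀ v w, sf x ![v, w] =
        stdSymplecticForm (mfderiv (𝓡 4) 𝓘(ℝ, E4) ψ x v) (mfderiv (𝓡 4) 𝓘(ℝ, E4) ψ x w)) →
      ∀ (R₁ : ℝ) (J : AlmostComplexStructure (𝓡 4) ∞ M), R < R₁ → 0 < R₁ → J.IsTamedBy sf →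
      (∀ x, x ∈ Kᶜ → R₁ < ‖ψ x‖ → ∀ (v : TangentSpace (𝓡 4) x) (a : E4),
          a = mfderiv (𝓡 4) 𝓘(ℝ, E4) ψ x v →
          mfderiv (𝓡 4) 𝓘(ℝ, E4) ψ x (J x v) = WithLp.toLp 2 ![-(a 1), a 0, -(a 3), a 2]) →
      ∀ σ : M ≃ₘ⟮𝓡 4, 𝓡 4⟯ E4,
        (∀ (x : M) (v : TangentSpace (𝓡 4) x) (a b : E4), a = mfderiv (𝓡 4) 𝓘(ℝ, E4) σ x v →
            b = mfderiv (𝓡 4) 𝓘(ℝ, E4) σ x (J x v) →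
            (a 2 = 0 → a 3 = 0 → b 2 = 0 ∧ b 3 = 0) ∧ (a 0 = 0 → a 1 = 0 → b 0 = 0 ∧ b 1 = 0)) →
        (∀ (x : M) (v : TangentSpace (𝓡 4) x), v ≠ 0 →
            0 < stdSymplecticForm (mfderiv (𝓡 4) 𝓘(ℝ, E4) σ x v)
              (mfderiv (𝓡 4) 𝓘(ℝ, E4) σ x (J x v))) →
        (∀ w : E4, R₁ ^ 2 < w 0 ^ 2 + w 1 ^ 2 → (σ (χ w)) 0 = w 0 ∧ (σ (χ w)) 1 = w 1) →
        (∀ w : E4, R₁ ^ 2 < w 2 ^ 2 + w 3 ^ 2 → (σ (χ w)) 2 = w 2 ∧ (σ (χ w)) 3 = w 3) →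
        (∃ g : E4 → E2, ContDiffOn ℝ ∞ g {p : E4 | p 0 ^ 2 + p 1 ^ 2 < R₁⁻¹ ^ 2} ∧
          (∀ p q : E4, p 0 ^ 2 + p 1 ^ 2 < R₁⁻¹ ^ 2 → (p 0 ≠ 0 ∨ p 1 ≠ 0) →
            q = σ (χ (WithLp.toLp 2
              ![p 0 / (p 0 ^ 2 + p 1 ^ 2), -(p 1) / (p 0 ^ 2 + p 1 ^ 2), p 2, p 3])) →
            g p = WithLp.toLp 2 ![q 2, q 3]) ∧
          (∀ p : E4, p 0 = 0 → p 1 = 0 → g p = WithLp.toLp 2 ![p 2, p 3])) →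
        (∃ h : E4 → E2, ContDiffOn ℝ ∞ h {p : E4 | p 2 ^ 2 + p 3 ^ 2 < R₁⁻¹ ^ 2} ∧
          (∀ p q : E4, p 2 ^ 2 + p 3 ^ 2 < R₁⁻¹ ^ 2 → (p 2 ≠ 0 ∨ p 3 ≠ 0) →
            q = σ (χ (WithLp.toLp 2
              ![p 0, p 1, p 2 / (p 2 ^ 2 + p 3 ^ 2), -(p 3) / (p 2 ^ 2 + p 3 ^ 2)])) →
            h p = WithLp.toLp 2 ![q 0, q 1]) ∧
          (∀ p : E4, p 2 = 0 → p 3 = 0 → h p = WithLp.toLp 2 ![p 0, p 1])) →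
        ∃ (Φ₁ : M ≃ₘ⟮𝓡 4, 𝓡 4⟯ E4) (K₁ : Set M), IsCompact K₁ ∧ K ⊆ K₁ ∧
          (∀ x, x ∉ K₁ → Φ₁ x = ψ x) ∧
          ∀ (x : M) (v : TangentSpace (𝓡 4) x), v ≠ 0 →
            0 < stdSymplecticForm (mfderiv (𝓡 4) 𝓘(ℝ, E4) Φ₁ x v)
              (mfderiv (𝓡 4) 𝓘(ℝ, E4) Φ₁ x (J x v)) := by
  sorry

/-- **Stub 6 — compactly supported TAME Moser, relative to the end (L formally; card S6 `SplitTaming`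
+ S7 `CompactMoserR4`; = the triage-checked first lemma `TameMoserRelEnd` of ruled-cap-incidence-shear,
`Cruxes/…/SketchIdeator2.lean`, verbatim; Wendl 2018 p. 139 last paragraph made relative, McDuff–Salamon
2017 §3.2 Moser's trick).**  `sf` smooth closed, `Φ : M ≃ₘ ℝ⁴` a diffeomorphism equal to `ψ` off the
compact `K`, `sf = ψ*ω₀` off `K`, and an almost complex structure `J` tamed both by `sf` and by `Φ*ω₀`;
then some `Φ' : M ≃ₘ ℝ⁴` has `sf = Φ'*ω₀` everywhere and `Φ' = ψ` off a compact set — the crux's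
conclusion verbatim.  Proof plan: `ω_s := (1−s) sf + s Φ*ω₀` tames `J` for all `s ∈ [0,1]` (convexity
of the tame cone), hence is non-degenerate; `τ := Φ*ω₀ − sf` is closed and vanishes on the OPEN `Kᶜ`
(`K` compact hence closed; there `Φ = ψ` locally so `dΦ = dψ`); transport to `ℝ⁴` by `Φ`: a closed
2-form with compact support on `ℝ⁴` is `dβ` with `β` compactly supported (`H²_c(ℝ⁴) = 0`: radial homotopy
operator, then kill the closed tail on `{‖w‖ > r} ≃ S³ × ℝ`, `H¹(S³) = 0`); the Moser field
`ι_{V_s} ω_s = −β` is smooth, compactly supported, so its flow `ρ_s` exists for all times, is a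
diffeomorphism, is the identity off `supp β`, and `d/ds (ρ_s* ω_s) = ρ_s*(d ι_V ω_s + τ) = 0`, so
`ρ₁*(Φ*ω₀) = sf`; `Φ' := Φ ∘ ρ₁`, `K' := K ∪ Φ⁻¹(Φ(supp β))`.  Sanity: the standard model (`M = ℝ⁴`,
`sf = ω₀`, `Φ = refl`, `ψ = id`, `J = i ⊕ i`) satisfies hypotheses and conclusion (`Φ' = refl`), cf.
`gromov_recognitionR4_relEnd.stdModel_conclusion`.  Honours `_false_without_pullback` (H10 off `K` is a
verbatim hypothesis) and §7 (`K' ⊋ K` allowed).  Formal cost: compactly supported Poincaré lemma in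
degree 2 on `ℝ⁴` over `MForm`/`mextDeriv`, global flow of a compactly supported time-dependent field with
SMOOTH dependence (Mathlib has `IsPicardLindelof`, integral curves; smooth dependence/completeness to be
built) — the infrastructure item shared by every symplectic line of the summit (crux NOTES §5).
Leans on: `MForm`, `mextDeriv`, `IsClosedForm`, `MForm.pullback`, `AlmostComplexStructure.IsTamedBy`,
`IsTamedBy.pos`, `stdSymplecticMForm`, `Diffeomorph.trans`. [cite: McDuffSalamon2017, §3.2 (Moser);
Wendl2018, proof of Thm 6.8, p. 139] -/
theorem stub_tameMoser :
    ∀ (M : Type) [TopologicalSpace M] [T2Space M] [SecondCountableTopology M]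
      [ChartedSpace E4 M] [IsManifold (𝓡 4) ∞ M]
      (sf : MForm (𝓡 4) M ℝ 2) (J : AlmostComplexStructure (𝓡 4) ∞ M)
      (K : Set M) (ψ : M → E4) (Φ : M ≃ₘ⟮𝓡 4, 𝓡 4⟯ E4),
      IsSmoothForm sf → IsClosedForm sf → IsCompact K →
      (∀ x, x ∉ K → Φ x = ψ x) →
      (∀ x, x ∉ K → ∀ v w, sf x ![v, w] =
        stdSymplecticForm (mfderiv (𝓡 4) 𝓘(ℝ, E4) ψ x v) (mfderiv (𝓡 4) 𝓘(ℝ, E4) ψ x w)) →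
      J.IsTamedBy sf →
      (∀ (x : M) (v : TangentSpace (𝓡 4) x), v ≠ 0 →
        0 < stdSymplecticForm (mfderiv (𝓡 4) 𝓘(ℝ, E4) Φ x v)
              (mfderiv (𝓡 4) 𝓘(ℝ, E4) Φ x (J x v))) →
      ∃ Φ' : M ≃ₘ⟮𝓡 4, 𝓡 4⟯ E4,
        (∀ x v w, sf x ![v, w] =
          stdSymplecticForm (mfderiv (𝓡 4) 𝓘(ℝ, E4) Φ' x v) (mfderiv (𝓡 4) 𝓘(ℝ, E4) Φ' x w)) ∧
        ∃ K' : Set M, IsCompact K' ∧ ∀ x, x ∉ K' → Φ' x = ψ x := by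
  sorry

/-! ## The composition (kernel-checked; no `sorry` of its own) -/

/-- **The line concludes the crux BY NAME.**  Stub 1 (end does not return) → Stub 2 (tame `J`,
integrable on a sub-end, `R₁ > max R 0`) → Stub 3 (wedge cap `X`) → Stub 4 (APEX: bi-foliation chart
`σ`, using `π₂(M) = 0` here only) → Stub 5 (decay + tame cut-off `Φ₁ = ψ` off compact `K₁ ⊇ K`) →
Stub 6 (compactly supported tame Moser) = the crux's conclusion.  Pure logic: the ten crux hypotheses
are threaded to the stubs that consume them (H1 → Stub 4; H2 → 1,2,3,6; H3 → 3,6; H4 → 2,3;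
H5 → 1,2,3,5; H6/H8 → 1,2,3,4,5; H7/H9 → 1,3,4,5; H10 → 1,2,3,5 and, off `K₁ ⊇ K`, 6). -/
theorem GromovRecognitionRelEnd_of :
    Summit.SmoothPoincare4.SmoothPoincare4.Theses.SymplecticOrigami.GromovRecognitionRelEnd := by
  intro M _ _ _ _ _ _ sf K R ψ χ h1 h2 h3 h4 h5 h6 h7 h8 h9 h10
  -- Stub 1: the truncations are open
  have hopen : ∀ R', R < R' → IsOpen (K ∪ {x | x ∈ Kᶜ ∧ ‖ψ x‖ < R'}) :=
    stub_endDoesNotReturn M sf K R ψ χ h2 h5 h6 h7 h8 h9 h10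
  -- Stub 2: a tame `J`, integrable beyond `R₁`
  obtain ⟨R₁, J, hR₁, hR₁pos, hJt, hJstd⟩ := stub_tameJ M sf K R ψ h2 h4 h5 h6 h8 h10 hopen
  -- Stub 3: the wedge cap
  obtain ⟨X, _, _, _, _, _, _, _, ωX, JX, ι, ηH, ηV, ηC, hW⟩ :=
    stub_capModel M sf K R ψ χ h2 h3 h4 h5 h6 h7 h8 h9 h10 hopen R₁ J hR₁ hR₁pos hJt hJstd
  -- Stub 4 (apex): the bi-foliation chart
  obtain ⟨σ, hB1, hB2, hB3a, hB3b, hB4, hB5⟩ :=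
    stub_biFoliation M J K R R₁ ψ χ h1 h6 h7 h8 h9 hR₁ hR₁pos hJstd X ωX JX ι ηH ηV ηC hW
  -- Stub 5: decay + tame cut-off
  obtain ⟨Φ₁, K₁, hK₁, hKK₁, hΦψ, htame⟩ :=
    stub_flatCutoff M sf K R ψ χ h5 h6 h7 h8 h9 h10 R₁ J hR₁ hR₁pos hJt hJstd σ
      hB1 hB2 hB3a hB3b hB4 hB5
  -- Stub 6: compactly supported tame Moser
  exact stub_tameMoser M sf J K₁ ψ Φ₁ h2 h3 hK₁ hΦψ
    (fun x hx v w => h10 x (fun hxK => hx (hKK₁ hxK)) v w) hJt htame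

/-- The same term closes the Literature named fact (the SymplecticCap copy of the crux is this
constant, `crux_iff_literature`). -/
theorem gromov_recognitionR4_relEnd_of_line : gromov_recognitionR4_relEnd :=
  crux_iff_literature.1 GromovRecognitionRelEnd_of

/-! ## Sanity (kernel-checked): the composition's threading of H10 to `K₁ ⊇ K` and the tame cone

Two tiny checks that the interfaces are not vacuous by accident: (i) the standard complex structure
written inline is tamed by `ω₀` with constant `‖q‖²`; (ii) the tame cone is convex (the fact Stub 6's
linear path rests on), in the pointwise form used there. -/

/-- `ω₀(q, (i ⊕ i) q) = ‖q‖²` for the inline standard structure (so `i ⊕ i` is `ω₀`-tame and the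
`ψ`-coordinate computations of Stubs 2 and 5 have the stated constant). -/
theorem stdSymplecticForm_I4 (q : E4) :
    stdSymplecticForm q (WithLp.toLp 2 ![-(q 1), q 0, -(q 3), q 2]) =
      q 0 ^ 2 + q 1 ^ 2 + q 2 ^ 2 + q 3 ^ 2 := by
  simp [stdSymplecticForm]
  ring

/-- Convexity of the tame cone, pointwise: if two bilinear pairings are positive on `(v, Jv)` then so
is every convex combination (Stub 6's `ω_s`). -/
theorem tame_convex {a b s : ℝ} (ha : 0 < a) (hb : 0 < b) (hs0 : 0 ≤ s) (hs1 : s ≤ 1) :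
    0 < (1 - s) * a + s * b := by
  rcases eq_or_lt_of_le hs1 with rfl | hlt
  · simpa using hb
  · have : 0 < (1 - s) * a := mul_pos (by linarith) ha
    nlinarith [mul_nonneg hs0 hb.le]

end Summit.SmoothPoincare4.SmoothPoincare4.Cruxes.GromovRecognitionRelEnd.CrossCapLaurent

end
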